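import Literature.Topology.FourManifolds.CircleLoopNullhomotopy
import Literature.Geometry.Riemannian.MeanConvexSurrounding
import Literature.AlgebraicTopology.FundamentalGroup.VanKampenKernel
import Literature.AlgebraicTopology.FundamentalGroup.IsotopyTrack

/-!
# Path-class bookkeeping: squares with moving end points, reparametrisation along a curve,
# loops of circle maps under homotopies, and enlarging the subspace in `π₁(X, A) = 0`

Topic `Literature/Topology/FourManifolds` (infrastructure for the fact seat
`provefact-Literature.Geometry.Riemannian.LawsonMichelsohn1984_surrounding`: Wall's form of the
trading of `1`-handles, *Geometrical connectivity I* (1971), replaces Milnor's hypothesis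
`π₁(W) = 1` in the proof of Thm. 8.1 Index 1 by `π₁(W, V) = 0`; the circles of that proof then
have to be followed through flows and smoothings *with their classes*, which is pure path
bookkeeping, collected here).  Everything is **proved**; no named facts.

* `homotopic_of_square` — **square lemma with moving end points**: for a continuous map `G`
  of the unit square, the top edge is homotopic rel end points to
  (left edge)⁻¹ · (bottom edge) · (right edge) (Hatcher, *Algebraic Topology* (2002), proof of
  Lemma 1.19; from the tree's `VanKampen.homotopicWithin_of_square`).
* `homotopic_of_comp_real` — **reparametrisation principle along a curve `P : ℝ → Y`**: two
  paths `P ∘ p₁`, `P ∘ p₂` with continuous parameter functions agreeing at `0` and `1` are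
  homotopic rel end points (the tree's `PathSegment.homotopic_of_extend` for an arbitrary
  continuous curve instead of `Path.extend`).
* `ContinuousMap.circleLoop_homotopic_cast_of_homotopy` — a homotopy of circle maps which does
  not move the base point gives a homotopy rel end points of their loops;
  `ContinuousMap.mk_circleLoop_eq_of_homotopy` — under an arbitrary homotopy the loop of the end
  map is the conjugate of the loop of the start map by the track of the base point (Hatcher,
  Lemma 1.19), so null-homotopy of the loop passes along free homotopies
  (`ContinuousMap.circleLoop_homotopic_refl_of_homotopy`).
* `RelPiOneTrivial.of_joinedIn` — **enlarging `A` in `π₁(X, A) = 0`**: if every path with end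
  points in `A` compresses into `A`, and every point of `C ⊇ A` is joined inside `C` to a point
  of `A`, then every path with end points in `C` compresses into `C`.
* `Topology.IsEmbedding.exists_path_eq_map` — a path of `W` inside the image of an embedding
  `ι : V → W` is the image of a path of `V`.

## References

* A. Hatcher, *Algebraic Topology* (2002), §1.1, Lemma 1.19 and its proof; §4.1 (compression).
  [HatcherAT2002]
-/

open scoped unitInterval Topology
open Set Function
open Literature.AlgebraicTopology.FundamentalGroup

noncomputable section

namespace Literature.Topology.FourManifolds

universe u

/-! ### Squares with moving end points -/

section Square

variable {Y : Type*} [TopologicalSpace Y]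

/-- **Square lemma with moving end points, in the path groupoid.**  For a continuous map `G`
of the unit square `[0, 1] × [0, 1]` (first coordinate: the deformation parameter) with bottom
edge `κ = G(0, ·)`, top edge `ρ = G(1, ·)`, left edge `τ₀ = G(·, 0)` and right edge
`τ₁ = G(·, 1)` (any paths with these values): `[ρ] = [τ₀]⁻¹ · [κ] · [τ₁]`.
[cite: HatcherAT2002, Lemma 1.19 (proof)] -/
theorem mk_eq_of_square (G : C(I × I, Y)) {a b c d : Y} (κ : Path a b) (ρ : Path c d)
    (τ₀ : Path a c) (τ₁ : Path b d) (hκ : ∀ t, κ t = G (0, t)) (hρ : ∀ t, ρ t = G (1, t))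
    (h₀ : ∀ s, τ₀ s = G (s, 0)) (h₁ : ∀ s, τ₁ s = G (s, 1)) :
    Path.Homotopic.Quotient.mk ρ =
      ((Path.Homotopic.Quotient.mk τ₀).symm.trans (Path.Homotopic.Quotient.mk κ)).trans
        (Path.Homotopic.Quotient.mk τ₁) := by
  obtain ⟨F, -⟩ := VanKampen.homotopicWithin_of_square (S := (univ : Set Y)) G
    (fun _ => mem_univ _) κ τ₁ τ₀ ρ hκ h₁ h₀ hρ
  have h : Path.Homotopic.Quotient.mk (κ.trans τ₁) = Path.Homotopic.Quotient.mk (τ₀.trans ρ) :=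
    Path.Homotopic.Quotient.eq.2 ⟨F⟩
  rw [Path.Homotopic.Quotient.mk_trans, Path.Homotopic.Quotient.mk_trans] at h
  rw [Path.Homotopic.Quotient.trans_assoc, h, ← Path.Homotopic.Quotient.trans_assoc,
    Path.Homotopic.Quotient.symm_trans, Path.Homotopic.Quotient.refl_trans]

/-- **Square lemma with moving end points.**  In the situation of `mk_eq_of_square`, the top
edge is homotopic rel end points to `τ₀⁻¹ · κ · τ₁`. [cite: HatcherAT2002, Lemma 1.19 (proof)] -/
theorem homotopic_of_square (G : C(I × I, Y)) {a b c d : Y} (κ : Path a b) (ρ : Path c d)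
    (τ₀ : Path a c) (τ₁ : Path b d) (hκ : ∀ t, κ t = G (0, t)) (hρ : ∀ t, ρ t = G (1, t))
    (h₀ : ∀ s, τ₀ s = G (s, 0)) (h₁ : ∀ s, τ₁ s = G (s, 1)) :
    ρ.Homotopic ((τ₀.symm.trans κ).trans τ₁) := by
  apply Path.Homotopic.Quotient.eq.1
  rw [mk_eq_of_square G κ ρ τ₀ τ₁ hκ hρ h₀ h₁, Path.Homotopic.Quotient.mk_trans,
    Path.Homotopic.Quotient.mk_trans, Path.Homotopic.Quotient.mk_symm]

/-- **A deformation fixing the end points gives a homotopy rel end points**: if `G` is a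
continuous map of the square whose left and right edges are constant, its top edge is
homotopic rel end points to its bottom edge. [folklore] -/
theorem homotopic_of_square_of_const (G : C(I × I, Y)) {a b : Y} (κ ρ : Path a b)
    (hκ : ∀ t, κ t = G (0, t)) (hρ : ∀ t, ρ t = G (1, t))
    (h₀ : ∀ s, G (s, 0) = a) (h₁ : ∀ s, G (s, 1) = b) : ρ.Homotopic κ := by
  have h := homotopic_of_square G κ ρ (Path.refl a) (Path.refl b) hκ hρ
    (fun s => (h₀ s).symm) (fun s => (h₁ s).symm)
  refine h.trans ?_
  have e1 : ((Path.refl a).symm.trans κ).Homotopic κ := by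
    rw [Path.refl_symm]
    exact Path.Homotopic.Quotient.eq.1 (by
      rw [Path.Homotopic.Quotient.mk_trans, Path.Homotopic.Quotient.mk_refl,
        Path.Homotopic.Quotient.refl_trans])
  have e2 : ((((Path.refl a).symm.trans κ)).trans (Path.refl b)).Homotopic
      (((Path.refl a).symm.trans κ)) :=
    Path.Homotopic.Quotient.eq.1 (by
      rw [Path.Homotopic.Quotient.mk_trans, Path.Homotopic.Quotient.mk_refl,
        Path.Homotopic.Quotient.trans_refl])
  exact e2.trans e1

end Square

/-! ### Reparametrisation along a curve -/

section Reparam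

variable {Y : Type*} [TopologicalSpace Y]

/-- **The reparametrisation principle along a continuous curve.**  Two paths which factor
through one continuous curve `P : ℝ → Y`, `δᵢ = P ∘ pᵢ` with continuous parameter functions
`pᵢ : [0, 1] → ℝ` agreeing at `0` and at `1`, are homotopic rel end points: interpolate the
parameters linearly (no monotonicity is needed). [folklore] -/
theorem homotopic_of_comp_real {P : ℝ → Y} (hP : Continuous P) {a b : Y} (δ₁ δ₂ : Path a b)
    (p₁ p₂ : I → ℝ) (hp₁ : Continuous p₁) (hp₂ : Continuous p₂) (h₁ : ∀ t, δ₁ t = P (p₁ t))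
    (h₂ : ∀ t, δ₂ t = P (p₂ t)) (h0 : p₁ 0 = p₂ 0) (h1 : p₁ 1 = p₂ 1) : δ₁.Homotopic δ₂ := by
  refine ⟨{ toFun := fun q => P ((1 - (q.1 : ℝ)) * p₁ q.2 + (q.1 : ℝ) * p₂ q.2)
            continuous_toFun := by
              refine hP.comp ?_
              fun_prop
            map_zero_left := fun t => by simp [h₁ t]
            map_one_left := fun t => by simp [h₂ t]
            prop' := fun s t ht => ?_ }⟩
  simp only [mem_insert_iff, mem_singleton_iff] at ht
  show P ((1 - (s : ℝ)) * p₁ t + (s : ℝ) * p₂ t) = δ₁ t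
  rcases ht with rfl | rfl
  · rw [h₁, ← h0]; congr 1; ring
  · rw [h₁, ← h1]; congr 1; ring

/-- **Back and forth along a curve is null-homotopic**: a loop which factors through a
continuous curve `P : ℝ → Y` with a continuous parameter function taking the same value at `0`
and `1` is homotopic rel end points to the constant loop. [folklore] -/
theorem homotopic_refl_of_comp_real {P : ℝ → Y} (hP : Continuous P) {a : Y} (δ : Path a a)
    (p : I → ℝ) (hp : Continuous p) (h : ∀ t, δ t = P (p t)) (h01 : p 0 = p 1) :
    δ.Homotopic (Path.refl a) := by
  have ha : P (p 0) = a := by rw [← h 0, δ.source]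
  exact homotopic_of_comp_real hP δ (Path.refl a) p (fun _ => p 0) hp continuous_const h
    (fun _ => ha.symm) rfl h01.symm

end Reparam

/-! ### Loops of circle maps under homotopies -/

section CircleMaps

variable {Y : Type*} [TopologicalSpace Y]

/-- **A homotopy of circle maps which does not move the base point gives a homotopy rel end
points of their loops** (the loops `t ↦ e (cos 2πt, sin 2πt)`, `ContinuousMap.circleLoop`).
[folklore] -/
theorem _root_.ContinuousMap.circleLoop_homotopic_cast_of_homotopy
    {f g : C(Metric.sphere (0 : EuclideanSpace ℝ (Fin 2)) 1, Y)} (H : f.Homotopy g)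
    (hfix : ∀ s, H (s, circlePoint 0) = f (circlePoint 0)) :
    f.circleLoop.Homotopic (g.circleLoop.cast ((hfix 1).symm.trans (H.apply_one _))
      ((hfix 1).symm.trans (H.apply_one _))) := by
  refine ⟨{ toFun := fun q => H (q.1, circleParam q.2)
            continuous_toFun := H.continuous.comp (continuous_fst.prodMk
              (circleParam.continuous.comp continuous_snd))
            map_zero_left := fun t => ?_
            map_one_left := fun t => ?_
            prop' := fun s t ht => ?_ }⟩
  · show H (0, circleParam t) = f.circleLoop t
    rw [H.apply_zero]; rfl
  · show H (1, circleParam t) = (g.circleLoop.cast _ _) t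
    rw [H.apply_one]; rfl
  · show H (s, circleParam t) = f.circleLoop t
    simp only [mem_insert_iff, mem_singleton_iff] at ht
    rcases ht with rfl | rfl
    · rw [circleParam_zero, hfix]
      show f (circlePoint 0) = f (circleParam 0)
      rw [circleParam_zero]
    · rw [circleParam_one, hfix]
      show f (circlePoint 0) = f (circleParam 1)
      rw [circleParam_one]

/-- **Track formula for loops of circle maps** (Hatcher (2002), Lemma 1.19): under a homotopy
`H` from `f` to `g`, the loop of `g` is the conjugate of the loop of `f` by the track of the base
point, `[loop g] = [H(·, 1)]⁻¹ · [loop f] · [H(·, 1)]`. [cite: HatcherAT2002, Lemma 1.19] -/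
theorem _root_.ContinuousMap.mk_circleLoop_eq_of_homotopy
    {f g : C(Metric.sphere (0 : EuclideanSpace ℝ (Fin 2)) 1, Y)} (H : f.Homotopy g) :
    Path.Homotopic.Quotient.mk g.circleLoop =
      ((Path.Homotopic.Quotient.mk (H.evalAt (circlePoint 0))).symm.trans
        (Path.Homotopic.Quotient.mk f.circleLoop)).trans
          (Path.Homotopic.Quotient.mk (H.evalAt (circlePoint 0))) := by
  have h := IsotopyTrack.mk_map_eq_of_homotopy H
    ((ContinuousMap.id (Metric.sphere (0 : EuclideanSpace ℝ (Fin 2)) 1)).circleLoop)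
  have e₁ : ((ContinuousMap.id _).circleLoop).map (map_continuous g) = g.circleLoop := by
    ext t; rfl
  have e₂ : ((ContinuousMap.id _).circleLoop).map (map_continuous f) = f.circleLoop := by
    ext t; rfl
  rw [e₁, e₂] at h
  exact h

/-- **Null-homotopy of the loop passes along free homotopies of circle maps**: if `f ≃ g` and
the loop of `f` is homotopic rel end points to the constant loop, so is the loop of `g` (a
conjugate of the trivial class is trivial). [cite: HatcherAT2002, Lemma 1.19] -/
theorem _root_.ContinuousMap.circleLoop_homotopic_refl_of_homotopy
    {f g : C(Metric.sphere (0 : EuclideanSpace ℝ (Fin 2)) 1, Y)} (H : f.Homotopy g)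
    (h : f.circleLoop.Homotopic (Path.refl _)) : g.circleLoop.Homotopic (Path.refl _) := by
  apply Path.Homotopic.Quotient.eq.1
  rw [ContinuousMap.mk_circleLoop_eq_of_homotopy H, Path.Homotopic.Quotient.eq.2 h,
    Path.Homotopic.Quotient.mk_refl, Path.Homotopic.Quotient.trans_refl,
    Path.Homotopic.Quotient.symm_trans, Path.Homotopic.Quotient.mk_refl]

/-- The loop of a composite `j ∘ e` is the image of the loop of `e` (pointwise form of
`ContinuousMap.circleLoop_comp`). [folklore] -/
theorem _root_.ContinuousMap.circleLoop_comp_apply {Z : Type*} [TopologicalSpace Z]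
    (e : C(Metric.sphere (0 : EuclideanSpace ℝ (Fin 2)) 1, Y)) (j : C(Y, Z)) (t : I) :
    (j.comp e).circleLoop t = j (e.circleLoop t) := rfl

end CircleMaps

/-! ### Paths inside the image of an embedding -/

section Embedding

variable {V W : Type*} [TopologicalSpace V] [TopologicalSpace W]

/-- **A path inside the image of an embedding lifts**: if `ι : V → W` is an embedding and `γ` is
a path of `W` from `ι a` to `ι b` with `range γ ⊆ range ι`, then `γ = ι ∘ γ'` for a path `γ'`
of `V` from `a` to `b`. [folklore] -/
theorem _root_.Topology.IsEmbedding.exists_path_eq_map {ι : V → W} (hι : Topology.IsEmbedding ι)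
    {a b : V} (γ : Path (ι a) (ι b)) (hγ : ∀ t, γ t ∈ range ι) :
    ∃ γ' : Path a b, γ'.map hι.continuous = γ := by
  set φ := hι.toHomeomorph with hφ
  have hφv : ∀ v, (φ v : W) = ι v := fun v => rfl
  refine ⟨{ toFun := fun t => φ.symm ⟨γ t, hγ t⟩
            continuous_toFun := φ.symm.continuous.comp (γ.continuous.subtype_mk _)
            source' := ?_
            target' := ?_ }, ?_⟩
  · apply φ.injective
    rw [φ.apply_symm_apply]
    exact Subtype.ext (show γ 0 = (φ a : W) by rw [hφv, γ.source])
  · apply φ.injective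
    rw [φ.apply_symm_apply]
    exact Subtype.ext (show γ 1 = (φ b : W) by rw [hφv, γ.target])
  · ext t
    show ι (φ.symm ⟨γ t, hγ t⟩) = γ t
    rw [← hφv, φ.apply_symm_apply]

/-- A path whose values lie in a set `S ⊆ range ι` lifts along the embedding `ι`, and the lift
takes values in `ι ⁻¹' S`. [folklore] -/
theorem _root_.Topology.IsEmbedding.exists_path_eq_map_of_subset {ι : V → W}
    (hι : Topology.IsEmbedding ι) {S : Set W} (hS : S ⊆ range ι)
    {a b : V} (γ : Path (ι a) (ι b)) (hγ : ∀ t, γ t ∈ S) :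
    ∃ γ' : Path a b, γ'.map hι.continuous = γ ∧ ∀ t, γ' t ∈ ι ⁻¹' S := by
  obtain ⟨γ', hγ'⟩ := hι.exists_path_eq_map γ fun t => hS (hγ t)
  refine ⟨γ', hγ', fun t => ?_⟩
  show ι (γ' t) ∈ S
  have : (γ'.map hι.continuous) t = γ t := by rw [hγ']
  rw [Path.map_coe, comp_apply] at this
  rw [this]
  exact hγ t

end Embedding

/-! ### Enlarging `A` in `π₁(X, A) = 0` -/

section RelPiOne

open Literature.Geometry.Riemannian

variable {X : Type*} [TopologicalSpace X]

/-- **Enlarging the subspace in `π₁(X, A) = 0`.**  If every path of `X` with end points in `A`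
is homotopic rel end points to a path in `A` (`RelPiOneTrivial X A`), `A ⊆ C`, and every point
of `C` is joined *inside `C`* to a point of `A`, then every path with end points in `C` is
homotopic rel end points to a path in `C`: run from the end points into `A` inside `C`,
compress the conjugated path into `A`, and run back. [cite: HatcherAT2002, §4.1 (compression lemma)] -/
theorem _root_.Literature.Geometry.Riemannian.RelPiOneTrivial.of_joinedIn {A C : Set X}
    (h : RelPiOneTrivial X A) (hAC : A ⊆ C) (hj : ∀ z ∈ C, ∃ a ∈ A, JoinedIn C z a) :
    RelPiOneTrivial X C := by
  intro z z' hz hz' β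
  obtain ⟨a, ha, hza⟩ := hj z hz
  obtain ⟨a', ha', hz'a'⟩ := hj z' hz'
  set v : Path z a := hza.somePath with hv
  set v' : Path z' a' := hz'a'.somePath with hv'
  have hvC : ∀ t, v t ∈ C := hza.somePath_mem
  have hv'C : ∀ t, v' t ∈ C := hz'a'.somePath_mem
  obtain ⟨κ, hκA, hκ⟩ := h ha ha' ((v.symm.trans β).trans v')
  refine ⟨(v.trans κ).trans v'.symm, ?_, ?_⟩
  · rw [Path.trans_range, Path.trans_range, Path.symm_range]
    refine union_subset (union_subset ?_ (hκA.trans hAC)) ?_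
    · rintro _ ⟨t, rfl⟩; exact hvC t
    · rintro _ ⟨t, rfl⟩; exact hv'C t
  · apply Path.Homotopic.Quotient.eq.1
    have hq : Path.Homotopic.Quotient.mk ((v.symm.trans β).trans v') =
        Path.Homotopic.Quotient.mk κ := Path.Homotopic.Quotient.eq.2 hκ
    rw [Path.Homotopic.Quotient.mk_trans, Path.Homotopic.Quotient.mk_trans,
      Path.Homotopic.Quotient.mk_symm, ← hq, Path.Homotopic.Quotient.mk_trans,
      Path.Homotopic.Quotient.mk_trans, Path.Homotopic.Quotient.mk_symm]
    simp only [Path.Homotopic.Quotient.trans_assoc, Path.Homotopic.Quotient.trans_symm,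
      Path.Homotopic.Quotient.trans_refl]
    rw [← Path.Homotopic.Quotient.trans_assoc, Path.Homotopic.Quotient.trans_symm,
      Path.Homotopic.Quotient.refl_trans]

/-- **`π₁(X, A) = 0` only depends on `A` up to paths inside a common superset fixing nothing**:
symmetric convenience form of `RelPiOneTrivial.of_joinedIn` for `A ⊆ C` where each point of
`C` can be joined inside `C` to `A`, packaged with `JoinedIn` produced from an explicit path. [folklore] -/
theorem _root_.Literature.Geometry.Riemannian.RelPiOneTrivial.of_forall_exists_path {A C : Set X}
    (h : RelPiOneTrivial X A) (hAC : A ⊆ C)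
    (hj : ∀ z ∈ C, ∃ a ∈ A, ∃ p : Path z a, ∀ t, p t ∈ C) : RelPiOneTrivial X C :=
  h.of_joinedIn hAC fun z hz => by
    obtain ⟨a, ha, p, hp⟩ := hj z hz
    exact ⟨a, ha, p, hp⟩

end RelPiOne

end Literature.Topology.FourManifolds

end
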